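import Summits.KontsevichZagierPeriods.KontsevichZagierPeriods.Theorems.LiouvilleUnfoldingAyoubPiLocalKernelRing
import Summits.KontsevichZagierPeriods.KontsevichZagierPeriods.Theorems.LiouvilleUnfoldingAyoubPiLocalKernel

/-!
# The nilradical cut of item stmt-KontsevichZagierPeriods-0541 (`LiouvilleUnfolding.AyoubPiLocalKernel`)

Support file (`--supports` stmt-KontsevichZagierPeriods-0541) for the line `SketchIdeator2` (card
`nilradical-cut`) of the crux.  Over the commutative formal period ring `P := KZ.FormalPeriodRing =
FormalRep ⧸ relations` with `p := KZ.toFormalPeriod (KZ.of KZ.piRep)` the class of the disc `[π]`, the item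
reads `∀ x : P, evalP x = 0 → ∃ N, p ^ N * x = 0` (`piLocalKernel_iff_forall_evalP`, p136024).  Replacing
"`p`-power torsion" by "`p`-locally nilpotent" and paying the difference with reducedness of `P[p⁻¹]` cuts the
item EXACTLY into two statements, which are the registered stubs of the line:

* (N) `∀ x, evalP x = 0 → ∃ N k, p ^ N * x ^ (k + 1) = 0` — the transcendence half;
* (R) `∀ x, (∃ N k, p ^ N * x ^ (k + 1) = 0) → ∃ N, p ^ N * x = 0` — the transcendence-free half.

Proved here, unconditionally: the cut is exact (`ayoubPiLocalKernel_iff_nil_and_locallyReduced`) and both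
halves follow from the summit; (N) in two further languages — prime ideals (`nilLocalKernel_iff_primes`: every
prime of `P` avoiding `p` contains `ker evalP`, i.e. every field-valued multiplicative move-invariant in
which `[π]` survives kills every combination of value `0`) and the localised ring
(`nilLocalKernel_iff_ker_eq_nilradical`: for every ring map `Ev : P[p⁻¹] →+* ℝ` extending the evaluation,
`ker Ev` is the nilradical — Ayoub's Conjecture 7 "up to nilpotents").  Nothing conjecture-grade is
asserted and no definition is introduced.  References: J. Ayoub, EMS Newsl. 91 (2014), Def. 6, Conj. 7;
A. Huber, S. Müller-Stach, *Periods and Nori Motives* (2017), Conj. 13.2.5, Rem. 13.2.4; M. Kontsevich,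
D. Zagier, *Periods* (2001), §4.1.  Mathlib: `Ideal.exists_le_prime_disjoint`,
`IsLocalization.map_eq_zero_iff`, `IsLocalization.mk'_surjective`, `nilradical`, `Commute.isNilpotent_mul_right`.
-/

noncomputable section

open Literature.NumberTheory.Transcendental

namespace Summit.KontsevichZagierPeriods.LiouvilleUnfolding.NilradicalCut

open Summit.KontsevichZagierPeriods.LiouvilleUnfolding.PiLocalKernelPosition
open Summit.KontsevichZagierPeriods.KontsevichZagierPeriods.Theses.LiouvilleUnfolding (AyoubPiLocalKernel)

/-! ## Soundness in nil form -/

/-- If `p ^ N * x ^ (k + 1) = 0` in `P` then `evalP x = 0` (`evalP` is a ring map to the domain `ℝ` and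
`evalP p = π ≠ 0`). [folklore] -/
theorem evalP_eq_zero_of_pow_mul_pow_succ_eq_zero {x : KZ.FormalPeriodRing} {N k : ℕ}
    (h : KZ.toFormalPeriod (KZ.of KZ.piRep) ^ N * x ^ (k + 1) = 0) : KZ.evalP x = 0 := by
  have h' := evalP_eq_zero_of_pow_mul_eq_zero h
  rw [map_pow] at h'
  exact (pow_eq_zero_iff (Nat.succ_ne_zero k)).mp h'

/-- A power of the disc class is never `0` in `P` (it evaluates to `π ^ N`). [folklore] -/
theorem piClass_pow_ne_zero (N : ℕ) : KZ.toFormalPeriod (KZ.of KZ.piRep) ^ N ≠ 0 := fun h =>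
  pow_ne_zero N evalP_piClass_ne_zero (by rw [← map_pow, h, map_zero])

/-! ## The cut is exact -/

/-- **Item 0541 ↔ (N) ∧ (R).** `→`: the torsion form is the nil form with `k = 0`, and a `p`-locally nil
class has value `0`, so the item applies to it. `←`: compose. [folklore] -/
theorem ayoubPiLocalKernel_iff_nil_and_locallyReduced :
    AyoubPiLocalKernel ↔
      ((∀ x : KZ.FormalPeriodRing, KZ.evalP x = 0 →
          ∃ N k : ℕ, KZ.toFormalPeriod (KZ.of KZ.piRep) ^ N * x ^ (k + 1) = 0) ∧
        (∀ x : KZ.FormalPeriodRing,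
          (∃ N k : ℕ, KZ.toFormalPeriod (KZ.of KZ.piRep) ^ N * x ^ (k + 1) = 0) →
            ∃ N : ℕ, KZ.toFormalPeriod (KZ.of KZ.piRep) ^ N * x = 0)) := by
  rw [ayoubPiLocalKernel_iff_piLocalKernel, piLocalKernel_iff_forall_evalP]
  constructor
  · intro h
    refine ⟨fun x hx => ?_, fun x ⟨N, k, hNk⟩ => h x (evalP_eq_zero_of_pow_mul_pow_succ_eq_zero hNk)⟩
    obtain ⟨N, hN⟩ := h x hx
    exact ⟨N, 0, by rw [zero_add, pow_one]; exact hN⟩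
  · rintro ⟨hnil, hred⟩ x hx
    exact hred x (hnil x hx)

/-- The composition as a term: (N) → (R) → item 0541. [folklore] -/
theorem ayoubPiLocalKernel_of_nil_of_locallyReduced
    (hN : ∀ x : KZ.FormalPeriodRing, KZ.evalP x = 0 →
      ∃ N k : ℕ, KZ.toFormalPeriod (KZ.of KZ.piRep) ^ N * x ^ (k + 1) = 0)
    (hR : ∀ x : KZ.FormalPeriodRing,
      (∃ N k : ℕ, KZ.toFormalPeriod (KZ.of KZ.piRep) ^ N * x ^ (k + 1) = 0) →
        ∃ N : ℕ, KZ.toFormalPeriod (KZ.of KZ.piRep) ^ N * x = 0) :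
    AyoubPiLocalKernel :=
  ayoubPiLocalKernel_iff_nil_and_locallyReduced.mpr ⟨hN, hR⟩

/-- **Both halves follow from the summit** (so neither is refutable short of refuting the Kontsevich–Zagier
period conjecture). [cite: KontsevichZagier2001, §1.2 Conjecture 1] -/
theorem nil_and_locallyReduced_of_summit (h : KontsevichZagierPeriods) :
    (∀ x : KZ.FormalPeriodRing, KZ.evalP x = 0 →
        ∃ N k : ℕ, KZ.toFormalPeriod (KZ.of KZ.piRep) ^ N * x ^ (k + 1) = 0) ∧
      (∀ x : KZ.FormalPeriodRing,
        (∃ N k : ℕ, KZ.toFormalPeriod (KZ.of KZ.piRep) ^ N * x ^ (k + 1) = 0) →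
          ∃ N : ℕ, KZ.toFormalPeriod (KZ.of KZ.piRep) ^ N * x = 0) :=
  ayoubPiLocalKernel_iff_nil_and_locallyReduced.mp (ayoubPiLocalKernel_of_summit h)

/-! ## (N) on the prime spectrum -/

/-- **Prime-ideal form of the transcendence half.** (N) holds iff every prime ideal of `P` not containing
the disc class contains the value-kernel: every multiplicative, move-invariant "integration theory" with
values in a domain in which `[π]` does not vanish kills every combination of value `0`. `→`: from
`p ^ N * x ^ (k+1) = 0 ∈ q` and `p ∉ q`. `←`: if no `p ^ a * x ^ (b+1)` vanishes, the multiplicative set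
`{p ^ a * x ^ b}` avoids `0`, so some prime avoids it (`Ideal.exists_le_prime_disjoint`), contradiction.
[cite: HuberMullerStachPeriods2017, Conj. 13.2.5] -/
theorem nilLocalKernel_iff_primes :
    (∀ x : KZ.FormalPeriodRing, KZ.evalP x = 0 →
        ∃ N k : ℕ, KZ.toFormalPeriod (KZ.of KZ.piRep) ^ N * x ^ (k + 1) = 0) ↔
      ∀ q : Ideal KZ.FormalPeriodRing, q.IsPrime → KZ.toFormalPeriod (KZ.of KZ.piRep) ∉ q →
        RingHom.ker KZ.evalP ≤ q := by
  set p := KZ.toFormalPeriod (KZ.of KZ.piRep) with hp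
  constructor
  · intro h q hq hpq x hx
    obtain ⟨N, k, hNk⟩ := h x hx
    have hmem : p ^ N * x ^ (k + 1) ∈ q := by rw [hNk]; exact q.zero_mem
    rcases hq.mem_or_mem hmem with h1 | h2
    · exact absurd (hq.mem_of_pow_mem N h1) hpq
    · exact hq.mem_of_pow_mem (k + 1) h2
  · intro h x hx
    by_contra hcon
    push Not at hcon
    let S : Submonoid KZ.FormalPeriodRing :=
      { carrier := {y | ∃ a b : ℕ, y = p ^ a * x ^ b}
        mul_mem' := by
          rintro _ _ ⟨a, b, rfl⟩ ⟨c, d, rfl⟩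
          exact ⟨a + c, b + d, by ring⟩
        one_mem' := ⟨0, 0, by simp⟩ }
    have h0 : (0 : KZ.FormalPeriodRing) ∉ S := by
      rintro ⟨a, b, hab⟩
      cases b with
      | zero => exact piClass_pow_ne_zero a (by simpa using hab.symm)
      | succ k => exact hcon a k hab.symm
    have hdisj : Disjoint ((⊥ : Ideal KZ.FormalPeriodRing) : Set KZ.FormalPeriodRing) S := by
      rw [Set.disjoint_left]
      intro y hy hyS
      rw [SetLike.mem_coe, Ideal.mem_bot] at hy
      subst hy
      exact h0 hyS
    obtain ⟨q, hq, -, hqS⟩ := Ideal.exists_le_prime_disjoint (⊥ : Ideal KZ.FormalPeriodRing) S hdisj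
    have hpq : p ∉ q := fun hpq' => Set.disjoint_left.mp hqS hpq' ⟨1, 0, by simp⟩
    have hxq : x ∉ q := fun hxq' => Set.disjoint_left.mp hqS hxq' ⟨0, 1, by simp⟩
    exact hxq (h q hq hpq hx)

/-! ## (N) in the localised ring: Conjecture 7 up to nilpotents -/

/-- `x` is `p`-locally nilpotent in `P` iff its image in `P[p⁻¹]` is nilpotent. [folklore] -/
theorem locallyNil_iff_isNilpotent_algebraMap (x : KZ.FormalPeriodRing) :
    (∃ N k : ℕ, KZ.toFormalPeriod (KZ.of KZ.piRep) ^ N * x ^ (k + 1) = 0) ↔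
      IsNilpotent (algebraMap KZ.FormalPeriodRing
        (Localization.Away (KZ.toFormalPeriod (KZ.of KZ.piRep))) x) := by
  set p := KZ.toFormalPeriod (KZ.of KZ.piRep) with hp
  constructor
  · rintro ⟨N, k, hNk⟩
    refine ⟨k + 1, ?_⟩
    rw [← map_pow, IsLocalization.map_eq_zero_iff (Submonoid.powers p)]
    exact ⟨⟨_, N, rfl⟩, hNk⟩
  · rintro ⟨n, hn⟩
    rw [← map_pow, IsLocalization.map_eq_zero_iff (Submonoid.powers p)] at hn
    obtain ⟨⟨m, N, rfl⟩, hm⟩ := hn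
    cases n with
    | zero => exact absurd (by simpa using hm) (piClass_pow_ne_zero N)
    | succ k => exact ⟨N, k, hm⟩

/-- For a ring map `Ev : P[p⁻¹] →+* ℝ` extending `evalP`: `Ev (x / s) = 0 ↔ evalP x = 0`. [folklore] -/
theorem map_mk'_eq_zero_iff
    (Ev : Localization.Away (KZ.toFormalPeriod (KZ.of KZ.piRep)) →+* ℝ)
    (hEv : Ev.comp (algebraMap KZ.FormalPeriodRing _) = KZ.evalP)
    (x : KZ.FormalPeriodRing) (s : Submonoid.powers (KZ.toFormalPeriod (KZ.of KZ.piRep))) :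
    Ev (IsLocalization.mk' _ x s) = 0 ↔ KZ.evalP x = 0 := by
  have hcomp : ∀ a, Ev (algebraMap KZ.FormalPeriodRing
      (Localization.Away (KZ.toFormalPeriod (KZ.of KZ.piRep))) a) = KZ.evalP a :=
    fun a => by rw [← hEv]; rfl
  have hunit : IsUnit (IsLocalization.mk' (Localization.Away (KZ.toFormalPeriod (KZ.of KZ.piRep)))
      (1 : KZ.FormalPeriodRing) s) := by
    refine IsUnit.of_mul_eq_one (algebraMap KZ.FormalPeriodRing
      (Localization.Away (KZ.toFormalPeriod (KZ.of KZ.piRep))) s) ?_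
    rw [IsLocalization.mk'_spec, map_one]
  rw [IsLocalization.mk'_eq_mul_mk'_one, map_mul, hcomp]
  constructor
  · intro h
    rcases mul_eq_zero.mp h with h0 | h0
    · exact h0
    · exact absurd h0 (hunit.map Ev).ne_zero
  · intro h
    rw [h, zero_mul]

/-- **(N) ↔ Ayoub's Conjecture 7 up to nilpotents**: the transcendence half holds iff for every ring map
`Ev : P[p⁻¹] →+* ℝ` extending the evaluation, `ker Ev` is exactly the nilradical of `P[p⁻¹]` (so that `Ev`
is injective on the reduced quotient).  `⊇` always holds since `ℝ` is reduced; an extension exists by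
`exists_ringHom_away_comp_eq_evalP`. [cite: Ayoub2014, Conj. 7] -/
theorem nilLocalKernel_iff_ker_eq_nilradical :
    (∀ x : KZ.FormalPeriodRing, KZ.evalP x = 0 →
        ∃ N k : ℕ, KZ.toFormalPeriod (KZ.of KZ.piRep) ^ N * x ^ (k + 1) = 0) ↔
      ∀ Ev : Localization.Away (KZ.toFormalPeriod (KZ.of KZ.piRep)) →+* ℝ,
        Ev.comp (algebraMap KZ.FormalPeriodRing _) = KZ.evalP →
          RingHom.ker Ev = nilradical _ := by
  set p := KZ.toFormalPeriod (KZ.of KZ.piRep) with hp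
  constructor
  · intro h Ev hEv
    apply le_antisymm
    · intro y hy
      rw [RingHom.mem_ker] at hy
      obtain ⟨⟨x, s⟩, rfl⟩ := IsLocalization.mk'_surjective (Submonoid.powers p) y
      simp only at hy ⊢
      have hx : KZ.evalP x = 0 := (map_mk'_eq_zero_iff Ev hEv x s).mp hy
      have hnil : IsNilpotent (algebraMap KZ.FormalPeriodRing (Localization.Away p) x) :=
        (locallyNil_iff_isNilpotent_algebraMap x).mp (h x hx)
      rw [IsLocalization.mk'_eq_mul_mk'_one]
      exact mem_nilradical.mpr (Commute.isNilpotent_mul_right (Commute.all _ _) hnil)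
    · intro y hy
      rw [RingHom.mem_ker]
      exact ((mem_nilradical.mp hy).map Ev).eq_zero
  · intro h x hx
    obtain ⟨Ev, hEv⟩ := exists_ringHom_away_comp_eq_evalP
    rw [locallyNil_iff_isNilpotent_algebraMap, ← mem_nilradical, ← h Ev hEv, RingHom.mem_ker,
      ← RingHom.comp_apply, hEv, hx]

end Summit.KontsevichZagierPeriods.LiouvilleUnfolding.NilradicalCut

end
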